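import Summits.QuantumAdvantage.QuantumAdvantage.Theorems.FlatDialStrings

/-!
# FlatDialRigid — module 5 of the FlatDial THEOREMS package (cell decomp-qadv, lens-3 generation 11, rev 3)

§12 THE RIGID CERTIFICATE.  Normality flats are not rigid (instrument K-FLAT8: a basis-dependent near-canonical family around every
`M`-subspace), DILLON SUBSPACES are: `G ∈ MM#` (completed Maiorana–McFarland) iff `G` has an `n/2`-dimensional subspace `V` with
`D_a D_b G ≡ 0` for all `a, b ∈ V` [cite: Dillon1974; PasalicPolujanKudinZhang2024, Lemma 1.2], and for `x·π(y)` with `π` APN-like that subspace is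
UNIQUE [cite: PasalicPolujanKudinZhang2024, Thm 3.1, Prop. 3.3/3.4].  This module types the `M`-CERTIFICATE search problem (`validMCerts`, `hasMSub`,
`mfinders`), proves that its `AC⁰[⊕]`-hardness (the node's piece `W_M`) is WEAKER than flat-search hardness `W` modulo the side condition
`N_M` («slice `G`-sides are in `MM#`») — ★ `no_mfinder_of_no_finder` — hence NECESSARY for item 27991 modulo `N_M` alone —
★ `no_mfinder_of_signedSlice_not_mem` — and proves the ATTACK SCHEMA ★★ `no_mfinder_of_mRecovery`: an `AC⁰[⊕]`-planted family of `MM#`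
signed cubic duals whose every `M`-certificate leaks `MOD₃` of the seed refutes every `AC⁰[⊕]` `M`-certificate finder (Smolensky).  The
record (NODE-g11.md §12) constructs such a family on paper — the unipotent width-3 `MOD₃`-program frame composed with the direct sum of the
cube-map Maiorana–McFarland function over `𝔽₈` (Lemma U: unique `M`-subspace; instruments K-MSUB, K-BPFRAME) — making `W_M` a theorem candidate.

IN-TREE NEIGHBOURS (cited, not restated): the MACHINE-level `M`-subspace sign readout of the parent route CubicForrelation —
`Literature/…/MSubspaceSignReadoutMachine.lean` (`MMReadout.certOK`: rank `n/2` + vanishing second differences, the list/circuit-code form of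
`validMCerts`; `x0Of` = the slope; the dual-pair sampler = the randomised form of module 1's exact readout `rho`), `ForrelationMSubspaceDuality.lean`,
`ForrelationCosetAffineBound.lean` (`DerivativeWalsh.abs_forrelation_le_half_of_affine_on_cosets`: no too-large coset-affine subspace in an exact
pair — the ingredient (U4) of the record's Lemma U) and the r3-refutation line `Cruxes/SignedExactCubicForrelationNotPrBPP/Lines/dual_pingpong_frame.lean`
whose open core is a POLYNOMIAL-TIME `M`-subspace finder.  This module is the `AC⁰[⊕]`-level, exact-slice counterpart and points the OTHER way: modulo
`N_M`, `AC⁰[⊕]` finders are NECESSARY for 27991 and (record §12) provably do NOT exist — `M`-subspace finding for exact cubic pairs embeds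
`𝔽₂`-linear algebra (a unipotent frame), so it is outside `AC⁰[⊕]` while its membership in `P` is the parent line's open stub.

Provenance: HOME/decomp-qadv-lens-3/g11/ (record NODE-g11.md §12–§13, ADDENDUM rev 3).  Namespace `Summit.QuantumAdvantage.QuantumAdvantage.Theorems.FlatDial`.
Uses BY NAME: modules 1–4 (`validCerts`, `hasFlatCert`, `signedCubicDuals`, `finders`, `realisableOutG`, `no_finder_of_signedSlice_not_mem`,
`not_acRealOver_mod3`), `ACRealOver.comp/mono/congr`, `natPoly_eval_mono`; nothing restated.  ZERO `def … : Prop`.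
-/

set_option linter.dupNamespace false

noncomputable section

namespace Summit.QuantumAdvantage.QuantumAdvantage.Theorems.FlatDial

open Finset
open Literature.Computability.Complexity
open Literature.Computability.QuantumComplexity
open Literature.Computability.MetaComplexity
open Literature.Computability.QuantumComplexity.BuzetChailloux (bxor)

/-! ## §12a `M`-certificates and the completed Maiorana–McFarland class in coordinates -/

section MSub

variable {n : ℕ}

/-- ★ THE VALID `M`-CERTIFICATES of `G`: valid flat certificates `(t, rows, x*)` whose row span `V` is a DILLON SUBSPACE of `G` — every
second derivative along `V` vanishes identically, i.e. `G` is affine on EVERY coset of `V`. [cite: PasalicPolujanKudinZhang2024, Lemma 1.2] -/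
def validMCerts (G : (Fin n → Bool) → Bool) : Set (CertIdx n → Bool) :=
  {c | c ∈ validCerts G ∧ ∀ (a b : Fin (n / 2) → Bool) (x : Fin n → Bool),
    xor (xor (G (bxor (bxor x (comb c a)) (comb c b))) (G (bxor x (comb c a)))) (xor (G (bxor x (comb c b))) (G x)) = false}

/-- Membership in `validMCerts` unfolded. -/
theorem mem_validMCerts {G : (Fin n → Bool) → Bool} {c : CertIdx n → Bool} : c ∈ validMCerts G ↔
    c ∈ validCerts G ∧ ∀ (a b : Fin (n / 2) → Bool) (x : Fin n → Bool),
      xor (xor (G (bxor (bxor x (comb c a)) (comb c b))) (G (bxor x (comb c a)))) (xor (G (bxor x (comb c b))) (G x)) = false :=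
  Iff.rfl

variable (n) in
/-- ★ `MM#` IN COORDINATES: the functions with an `M`-certificate (a Dillon subspace presented by independent rows). [cite: Dillon1974] -/
def hasMSub : Set ((Fin n → Bool) → Bool) := {G | ∃ c : CertIdx n → Bool, c ∈ validMCerts G}

/-- Membership in `hasMSub` unfolded. -/
theorem mem_hasMSub {G : (Fin n → Bool) → Bool} : G ∈ hasMSub n ↔ ∃ c : CertIdx n → Bool, c ∈ validMCerts G := Iff.rfl

/-- An `M`-certificate is a flat certificate: `MM# ⊆` weakly normal, in coordinates. -/
theorem hasFlatCert_of_hasMSub {G : (Fin n → Bool) → Bool} (h : G ∈ hasMSub n) : G ∈ hasFlatCert n := by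
  obtain ⟨c, hc⟩ := h
  exact ⟨c, hc.1⟩

end MSub

/-! ## §12b The `M`-certificate finders; `W_M` is weaker than `W` and necessary for 27991, modulo `N_M` -/

/-- ★ THE `M`-FINDERS: certificate maps that, reading the table of `G` alone, output a valid `M`-certificate on every signed cubic dual
`G ∈ MM#` of even arity.  The node's piece `W_M` («MSubSearchHard») is `¬ ∃ c ∈ realisableOutG CertIdx, c ∈ mfinders`. -/
def mfinders : Set ((n : ℕ) → (Fin (formN n) → Bool) → CertIdx n → Bool) :=
  {c | ∀ (n : ℕ) (u : Fin (formN n) → Bool), Even n → (gformOf n u).eval ∈ signedCubicDuals n →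
    (gformOf n u).eval ∈ hasMSub n → c n u ∈ validMCerts (gformOf n u).eval}

/-- Membership in `mfinders` unfolded. -/
theorem mem_mfinders {c : (n : ℕ) → (Fin (formN n) → Bool) → CertIdx n → Bool} : c ∈ mfinders ↔
    ∀ (n : ℕ) (u : Fin (formN n) → Bool), Even n → (gformOf n u).eval ∈ signedCubicDuals n →
      (gformOf n u).eval ∈ hasMSub n → c n u ∈ validMCerts (gformOf n u).eval := Iff.rfl

/-- `N_M → N`: if every slice `G`-side is in `MM#`, every slice `G`-side is weakly normal. -/
theorem sliceNormal_of_sliceMM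
    (hM : ∀ I : CubicANFPair, Even I.n → (I.value = 1 ∨ I.value = -1) → I.G.eval ∈ hasMSub I.n) :
    ∀ I : CubicANFPair, Even I.n → (I.value = 1 ∨ I.value = -1) → I.G.eval ∈ hasFlatCert I.n :=
  fun I hn hv => hasFlatCert_of_hasMSub (hM I hn hv)

/-- Under `N_M`, every signed cubic dual read from a one-form table is in `MM#`. -/
theorem hasMSub_of_sliceMM
    (hM : ∀ I : CubicANFPair, Even I.n → (I.value = 1 ∨ I.value = -1) → I.G.eval ∈ hasMSub I.n)
    {n : ℕ} (hn : Even n) {u : Fin (formN n) → Bool} (hd : (gformOf n u).eval ∈ signedCubicDuals n) :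
    (gformOf n u).eval ∈ hasMSub n := by
  obtain ⟨F, hF⟩ := hd
  exact hM ⟨n, F, gformOf n u⟩ hn hF

/-- ★ `W ∧ N_M → W_M` (kernel): modulo `N_M` an `M`-certificate finder IS a flat-certificate finder (the identity on certificates, depth
`+0`), so hardness of flat search implies hardness of `M`-certificate search. -/
theorem no_mfinder_of_no_finder
    (hM : ∀ I : CubicANFPair, Even I.n → (I.value = 1 ∨ I.value = -1) → I.G.eval ∈ hasMSub I.n)
    (w : ¬ ∃ c : (n : ℕ) → (Fin (formN n) → Bool) → CertIdx n → Bool, c ∈ realisableOutG CertIdx ∧ c ∈ finders) :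
    ¬ ∃ c : (n : ℕ) → (Fin (formN n) → Bool) → CertIdx n → Bool, c ∈ realisableOutG CertIdx ∧ c ∈ mfinders := by
  rintro ⟨c, hc, hvalid⟩
  exact w ⟨c, hc, fun n u hn hd _ => (hvalid n u hn hd (hasMSub_of_sliceMM hM hn hd)).1⟩

/-- ★ NECESSITY of `W_M` for item 27991 modulo `N_M` alone (kernel): `N_M → (SignedExactCubicSliceANF ∉ promiseLift (AC0Mod 2) → W_M)`. -/
theorem no_mfinder_of_signedSlice_not_mem
    (hM : ∀ I : CubicANFPair, Even I.n → (I.value = 1 ∨ I.value = -1) → I.G.eval ∈ hasMSub I.n)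
    (hT : SignedExactCubicSliceANF ∉ promiseLift (AC0Mod 2)) :
    ¬ ∃ c : (n : ℕ) → (Fin (formN n) → Bool) → CertIdx n → Bool, c ∈ realisableOutG CertIdx ∧ c ∈ mfinders :=
  no_mfinder_of_no_finder hM (no_finder_of_signedSlice_not_mem (sliceNormal_of_sliceMM hM) hT)

/-! ## §12c THE ATTACK SCHEMA FOR `W_M` (kernel): `AC⁰[⊕]`-planted `MM#` families whose every `M`-certificate leaks `MOD₃` -/

/-- ★ An `M`-RECOVERY FAMILY: for every seed length `m` an `AC⁰[⊕]`-PLANTED (each table bit a depth-`dP`, size-`≤ rP(m)` function of the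
seed) signed cubic dual `G_w ∈ MM#` of even arity `N(m) ≤ P(m)`, with an `AC⁰[⊕]` extractor recovering `MOD₃(w)` from the seed and ANY
valid `M`-certificate of `G_w`.  The record constructs one: `G_w = F_{m+1} ∘ ι ∘ M_w` (unipotent `MOD₃`-program frame, cube-map
Maiorana–McFarland direct sum; Lemma U), `E(c) = ⋀ᵢ ¬ rowᵢ(c)[(0,0)]`. -/
structure MRecovery where
  /-- arity of the planted function for seed length `m` -/
  N : ℕ → ℕ
  /-- polynomial arity bound -/
  P : Polynomial ℕ
  /-- the arity is polynomially bounded -/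
  hN : ∀ m, N m ≤ P.eval m
  /-- the arity is even -/
  even : ∀ m, Even (N m)
  /-- the table of the planted `G_w` -/
  plant : (m : ℕ) → (Fin m → Bool) → Fin (formN (N m)) → Bool
  /-- planting depth -/
  dP : ℕ
  /-- planting size polynomial -/
  rP : Polynomial ℕ
  /-- every table bit is an `AC⁰[⊕]` function of the seed -/
  plantAC : ∀ m k, ACRealOver (accBasis 2) (fun w => plant m w k) dP (rP.eval m)
  /-- the planted function is a signed cubic dual -/
  dual : ∀ m w, (gformOf (N m) (plant m w)).eval ∈ signedCubicDuals (N m)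
  /-- the planted function is in `MM#` -/
  msub : ∀ m w, (gformOf (N m) (plant m w)).eval ∈ hasMSub (N m)
  /-- the extractor -/
  E : (m : ℕ) → (Fin m → Bool) → (CertIdx (N m) → Bool) → Bool
  /-- extractor depth -/
  dE : ℕ
  /-- extractor size polynomial -/
  rE : Polynomial ℕ
  /-- composition-closed realisability of the extractor -/
  hE : ∀ (m : ℕ) (c : (Fin m → Bool) → CertIdx (N m) → Bool) (dc sc : ℕ),
    (∀ k, ACRealOver (accBasis 2) (fun w => c w k) dc sc) →
      ACRealOver (accBasis 2) (fun w => E m w (c w)) (dE + dc) (rE.eval m * (sc + 1))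
  /-- EVERY valid `M`-certificate of the planted function leaks `MOD₃` of the seed -/
  recover : ∀ (m : ℕ) (w : Fin m → Bool) (c : CertIdx (N m) → Bool),
    c ∈ validMCerts (gformOf (N m) (plant m w)).eval → E m w c = decide (GateFn.numOnes w % 3 = 0)

/-- ★★ THE ATTACK SCHEMA FOR `W_M` (kernel): an `M`-recovery family refutes every `AC⁰[⊕]` `M`-certificate finder (finder ∘ planting ∘
extractor would compute `MOD₃` in constant depth and polynomial size, contradicting Smolensky `not_acRealOver_mod3`). -/
theorem no_mfinder_of_mRecovery (R : MRecovery) :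
    ¬ ∃ c : (n : ℕ) → (Fin (formN n) → Bool) → CertIdx n → Bool, c ∈ realisableOutG CertIdx ∧ c ∈ mfinders := by
  rintro ⟨c, ⟨d, r, hc⟩, hvalid⟩
  apply not_acRealOver_mod3
  have hinner : ∀ m k, ACRealOver (accBasis 2) (fun w : Fin m → Bool => c (R.N m) (R.plant m w) k) (d + R.dP)
      (r.eval (R.N m) + formN (R.N m) * R.rP.eval m) := by
    intro m k
    have h := ACRealOver.comp (hc (R.N m) k) (f := fun k' (w : Fin m → Bool) => R.plant m w k') (d := R.dP)
      (s := fun _ => R.rP.eval m) (fun k' => R.plantAC m k')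
    refine h.mono le_rfl (le_of_eq ?_)
    simp [formN]
  refine ⟨R.dE + (d + R.dP), R.rE * (r.comp R.P + (R.P ^ 3 + 1) * R.rP + 1), fun m => ?_⟩
  have hE := R.hE m (fun w => c (R.N m) (R.plant m w)) (d + R.dP) (r.eval (R.N m) + formN (R.N m) * R.rP.eval m) (hinner m)
  refine (hE.mono le_rfl ?_).congr fun w => R.recover m w _ (hvalid (R.N m) (R.plant m w) (R.even m) (R.dual m w) (R.msub m w))
  have h1 : r.eval (R.N m) ≤ (r.comp R.P).eval m := by rw [Polynomial.eval_comp]; exact natPoly_eval_mono r (R.hN m)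
  have h2 : formN (R.N m) ≤ (R.P.eval m) ^ 3 + 1 := by
    rw [formN_eq]; exact Nat.add_le_add_right (Nat.pow_le_pow_left (R.hN m) 3) 1
  have h3 : r.eval (R.N m) + formN (R.N m) * R.rP.eval m + 1 ≤ (r.comp R.P + (R.P ^ 3 + 1) * R.rP + 1).eval m := by
    simp only [Polynomial.eval_add, Polynomial.eval_mul, Polynomial.eval_pow, Polynomial.eval_one]
    exact Nat.add_le_add (Nat.add_le_add h1 (Nat.mul_le_mul_right _ h2)) le_rfl
  simpa [Polynomial.eval_mul] using Nat.mul_le_mul_left (R.rE.eval m) h3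

end Summit.QuantumAdvantage.QuantumAdvantage.Theorems.FlatDial
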